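import Summits.AtomisticToContinuum.BoseEinsteinCondensation.Theorems.BECCutLineWeakDisorderFlatModeFromLandscape
import Literature.MathematicalPhysics.QuantumManyBody.LiebYngvasonBoxBound
import Literature.MathematicalPhysics.QuantumManyBody.BoseGasCatStates
import Mathlib
import HarnessLib

/-!
# Disproof of `LandscapeBound` (stmt-AtomisticToContinuum-9087) — findings

Crux (route `BECCutLineWeakDisorder`, rank 2; verbatim the hinge of retired `BECPalmLandscape`):
`∀ v` repulsive finite-range `∃ ρ₀ ∀ ρ ∈ (0, ρ₀) ∃ C > 0 ∀ᶠ n ∀ δ > 0 ∃ Ψ ∈ TrialState (n+1) L`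
(`L = ((n+1)/ρ)^{1/3}`), `δ`-near-minimising, NONNEGATIVE, with
`∫ L³ m(Y)²/s(Y)² dY ≤ C`, `m(Y) = ∫ |Ψ(x,Y)|² dx`, `s(Y) = ∫ |Ψ(x,Y)| dx`.

Standing disprover (cdisprove), cycle 1. Findings so far (details in the docstrings below):

1. ELABORATION / JUNK. The statement elaborates (rc 0). No junk handle: `a / b` in `ℝ≥0∞` with
   `s(Y) = 0` forces `m(Y) = 0` (slice `= 0` a.e.), so the integrand is `0`, never `⊤·junk`;
   `s(Y) < ⊤` (continuous compactly supported slice); `δ = ⊤` is allowed but only weakens one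
   instance; `TrialState (n+1) L` is inhabited (`L > 0`); `E₀ = ⊤` would make near-minimality
   vacuous but the ratio demand is then met by a product bump (ratio `O(1)`), so no ex-falso exit
   and no cheap counterexample through `E₀`.
2. TIGHTNESS (proved, § Tightness): for EVERY admissible trial state the landscape functional is
   `≥ 1` (`one_le_landscapeRatio`: Cauchy–Schwarz on the box slice + Tonelli), hence the constant of
   the crux satisfies `C ≥ 1` for every `(v, ρ)` (`one_le_const_of_landscape`), and the natural
   strengthening with a UNIVERSAL constant (`∀ C > 0`, `LandscapeBoundAnyConst`) is FALSE
   (`not_landscapeBoundAnyConst`, witness `v = 0`, `C = 1/2`). For `v = 0` the sharp value is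
   `(π²/8)³ ≈ 1.878` for near-minimisers (near-miss `freeGas_const_lt`, not closed: needs the
   Dirichlet cube's second eigenvalue in the `C¹` class).
3. LOAD-BEARING HYPOTHESES (paper analysis, no Lean kill available):
   * finite range / repulsive `v`: dropping finite range admits crystallising repulsions, for which
     the conditional amplitude `x ↦ Ψ₀(x,Y)` localises at the vacancy (`R(Y) ~ N`) — but quantum
     crystallisation is itself open; no landable `_false_without_`.
   * low density (`ρ < ρ₀`): at high density hard cores give `E₀ = ⊤` and the instance is then
     TRUE trivially (item 1), bounded `v` at high density is open physics — not refutable.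
   * `∀ᶠ n` vs `∀ n`: `n = 0` (one particle) has ratio `→ (π²/8)³` along near-minimisers; with `C`
     chosen after `ρ` the `∀ n` form is presumably still true — not load-bearing in a refutable way.
   * nonnegativity `Ψ = ‖Ψ‖`: dropping it WEAKENS the crux (the functional only sees `‖Ψ‖`); it is
     load-bearing for the ROUTE (flat-mode Cauchy–Schwarz `|⟨φ₀,Ψ(·,Y)⟩|² = L⁻³ s(Y)²` needs
     `Ψ ≥ 0`), not for the crux.
   * `∃ Ψ` vs `∀ Ψ`: PROVED (§ Unbounded) that at fixed `(n, L)` the functional is unbounded on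
     nonnegative admissible states (`exists_nonneg_landscapeRatio_ge`: sub-box power states,
     `≥ L³/ℓ³`), hence the `∀ δ ∀ Ψ` reading is false (`not_landscapeBound_forall_forall`, `δ = ⊤`)
     and the functional is NOT `L²`-controlled: `GroundStateRigidity` can transfer OCCUPATIONS (as
     `closes` does) but never the ratio itself. The honest `∃ δ ∀ Ψ` form is also false at every
     fixed `δ > 0` (thin symmetric spikes on a near-minimiser: mass `η²`, kinetic cost `η² N/w²`,
     ratio gain `η² L³/w³`, i.e. `δ/(ρ w) → ∞`; near-miss `not_landscapeBoundForall`, needs a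
     near-ground-state `C¹` witness; the lead's PICKED.md records the same computation).
4. PHYSICS-LEVEL ATTACK (why it resists): `E_Q[R] - 1 ≈ E_Y Var_x log Ψ₀(x,Y)`; at Jastrow /
   Bijl–Feynman level with the Reatto–Chester `1/r²` phonon tail, `Var_x Σ_j φ(x - y_j) ≈
   ρ ∫ φ̂(k)² S(k) d³k` with `φ̂ ~ 1/k`, `S ~ k`: IR-finite in `d = 3`, `N`-independent — the
   heuristic value is `1 + O(√(ρa³)) + O(ξ/L)`, bounded. A divergence needs either crystalline
   order or a `log L` replica coupling through slow bath time-correlations (`∫ s C(s) ds = ∞`),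
   for which Bogoliubov theory gives `C(s) ~ s⁻⁴` (convergent). No finite model: the statement is
   asymptotic in `N` over a continuum variational problem; `decide`/`kit` have no handle.
5. LINE `Sketch` (lead skeleton `Cruxes/LandscapeBound/Lines/Sketch.lean`, 4 stubs): joint
   sufficiency is PROVED there (`LandscapeBound_of`, case split bounded/unbounded `v`); stubs 1–2
   (`stub_flatModeCondensate`, `stub_removalChiSq`) are statements about the genuine ground state
   `fkGroundState` (no junk for bounded `v`: `GroundStateFeynmanKac_holds` is proved), both of
   open-problem strength, constants necessarily `≥ 1` (`∫ s₀² ≤ L³`, `χ² ≥ 0`); stub 3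
   (`stub_witnessOfGroundState`) is a regularisation transfer, plausible (`C ≥ 1` is forced by its
   hypothesis since `ratio(Ψ₀) ≥ 1`, so `C + 1 ≥ 2` leaves room); stub 4 is the crux verbatim for
   unbounded `v` (note: it also contains a.e.-trivial unbounded profiles such as `v = ⊤·1_{{0}}`,
   energetically the free gas). No stub is cheaply refutable; see `-- Line Sketch` below.
-/

noncomputable section

open MeasureTheory Set Filter Metric
open scoped ENNReal NNReal

namespace Summit.AtomisticToContinuum.BoseEinsteinCondensation.Cruxes.LandscapeBound.Disproof

open Literature.MathematicalPhysics.QuantumManyBody.BoseGas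
open Summit.AtomisticToContinuum.BoseEinsteinCondensation.Theses.BECCutLineWeakDisorder
open Summit.AtomisticToContinuum.BoseEinsteinCondensation.Theorems.FlatModeFromLandscape

variable {n : ℕ} {L : ℝ}

/-! ## Tightness: the landscape functional is at least `1` on every trial state -/

/-- `ofReal (L³) = (ofReal L)³` for every real `L` (both sides vanish for `L ≤ 0`). [folklore] -/
theorem ofReal_pow_three (L : ℝ) : ENNReal.ofReal (L ^ 3) = ENNReal.ofReal L ^ 3 := by
  rcases le_or_gt 0 L with hL | hL
  · exact ENNReal.ofReal_pow hL 3
  · have h3 : L ^ 3 ≤ 0 := by nlinarith [sq_nonneg L]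
    rw [ENNReal.ofReal_of_nonpos hL.le, ENNReal.ofReal_of_nonpos h3]
    norm_num

/-- **Cauchy–Schwarz on a box slice.** For an admissible trial state and every bath
configuration `Y`, `s(Y)² ≤ L³ · m(Y)`: the slice `x ↦ Ψ(x, Y)` vanishes off the box `Λ_L` of
volume `L³`. [folklore] -/
theorem lintegral_slice_sq_le (Ψ : TrialState (n + 1) L) (Y : Config n) :
    (∫⁻ x, (‖Ψ.ψ (Matrix.vecCons x Y)‖₊ : ℝ≥0∞)) ^ 2 ≤
      ENNReal.ofReal (L ^ 3) * ∫⁻ x, (‖Ψ.ψ (Matrix.vecCons x Y)‖₊ : ℝ≥0∞) ^ 2 := by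
  have hΨm : Measurable Ψ.ψ := Ψ.contDiff.continuous.measurable
  have hg : Measurable fun x : Space => (‖Ψ.ψ (Matrix.vecCons x Y)‖₊ : ℝ≥0∞) :=
    (measurable_comp_vecCons_left hΨm Y).nnnorm.coe_nnreal_ennreal
  set f : Space → ℝ≥0∞ := (box L).indicator 1 with hf
  have hfm : Measurable f := measurable_one.indicator (measurableSet_box L)
  have hfg : ∀ x, f x * (‖Ψ.ψ (Matrix.vecCons x Y)‖₊ : ℝ≥0∞) =
      (‖Ψ.ψ (Matrix.vecCons x Y)‖₊ : ℝ≥0∞) := by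
    intro x
    by_cases hx : x ∈ box L
    · simp [f, hx]
    · simp [f, hx, slice_eq_zero Ψ Y hx]
  have hf2 : ∫⁻ x, f x ^ 2 = ENNReal.ofReal (L ^ 3) := by
    have : (fun x => f x ^ 2) = (box L).indicator 1 := by
      funext x; by_cases hx : x ∈ box L <;> simp [f, hx]
    rw [this, lintegral_indicator_one (measurableSet_box L), volume_box, ofReal_pow_three]
  calc (∫⁻ x, (‖Ψ.ψ (Matrix.vecCons x Y)‖₊ : ℝ≥0∞)) ^ 2
      = (∫⁻ x, f x * (‖Ψ.ψ (Matrix.vecCons x Y)‖₊ : ℝ≥0∞)) ^ 2 := by simp_rw [hfg]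
    _ ≤ (∫⁻ x, f x ^ 2) * ∫⁻ x, (‖Ψ.ψ (Matrix.vecCons x Y)‖₊ : ℝ≥0∞) ^ 2 :=
        lintegral_mul_sq_le volume hfm.aemeasurable hg.aemeasurable
    _ = _ := by rw [hf2]

/-- **Pointwise tightness of the landscape integrand**: `m(Y) ≤ L³ m(Y)² / s(Y)²` for every `Y`
(from `s² ≤ L³ m`; where `s(Y) = 0` also `m(Y) = 0`; `s(Y) < ∞` since the slice is continuous with
compact support). [folklore] -/
theorem sliceMass_le_landscapeIntegrand (Ψ : TrialState (n + 1) L) (Y : Config n) :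
    ∫⁻ x, (‖Ψ.ψ (Matrix.vecCons x Y)‖₊ : ℝ≥0∞) ^ 2 ≤
      ENNReal.ofReal (L ^ 3) * (∫⁻ x, (‖Ψ.ψ (Matrix.vecCons x Y)‖₊ : ℝ≥0∞) ^ 2) ^ 2 /
        (∫⁻ x, (‖Ψ.ψ (Matrix.vecCons x Y)‖₊ : ℝ≥0∞)) ^ 2 := by
  have hΨm : Measurable Ψ.ψ := Ψ.contDiff.continuous.measurable
  have hslice : Measurable fun x : Space => (‖Ψ.ψ (Matrix.vecCons x Y)‖₊ : ℝ≥0∞) :=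
    (measurable_comp_vecCons_left hΨm Y).nnnorm.coe_nnreal_ennreal
  set m := ∫⁻ x, (‖Ψ.ψ (Matrix.vecCons x Y)‖₊ : ℝ≥0∞) ^ 2 with hm
  set s := ∫⁻ x, (‖Ψ.ψ (Matrix.vecCons x Y)‖₊ : ℝ≥0∞) with hs
  by_cases h0 : s = 0
  · have hm0 : m = 0 := by
      have h1 := (lintegral_eq_zero_iff hslice).1 h0
      refine (lintegral_eq_zero_iff (hslice.pow_const 2)).2 ?_
      filter_upwards [h1] with x hx
      simp only [Pi.zero_apply] at hx ⊢
      simp [hx]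
    rw [hm0]
    exact bot_le
  have hsfin : s ≠ ⊤ := (hasFiniteIntegral_iff_enorm.mp (integrable_slice Ψ Y).2).ne
  rw [ENNReal.le_div_iff_mul_le (Or.inl (pow_ne_zero 2 h0)) (Or.inl (ENNReal.pow_ne_top hsfin))]
  calc m * s ^ 2 ≤ m * (ENNReal.ofReal (L ^ 3) * m) := by
        gcongr
        exact lintegral_slice_sq_le Ψ Y
    _ = ENNReal.ofReal (L ^ 3) * m ^ 2 := by ring

/-- **Tightness of the crux's constant: the landscape functional is `≥ 1` on EVERY admissible
trial state** (nonnegative or not, near-minimising or not): `1 = ∫ m ≤ ∫ L³ m²/s²` (Tonelli in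
`x :: Y`, normalisation, pointwise tightness). Hence no `C < 1` can ever be witnessed.
[folklore] -/
theorem one_le_landscapeRatio (Ψ : TrialState (n + 1) L) :
    1 ≤ ∫⁻ Y : Config n, ENNReal.ofReal (L ^ 3) *
      (∫⁻ x, (‖Ψ.ψ (Matrix.vecCons x Y)‖₊ : ℝ≥0∞) ^ 2) ^ 2 /
        (∫⁻ x, (‖Ψ.ψ (Matrix.vecCons x Y)‖₊ : ℝ≥0∞)) ^ 2 := by
  have hΨm : Measurable Ψ.ψ := Ψ.contDiff.continuous.measurable
  calc (1 : ℝ≥0∞) = ∫⁻ Y : Config n, ∫⁻ x, (‖Ψ.ψ (Matrix.vecCons x Y)‖₊ : ℝ≥0∞) ^ 2 := by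
        rw [lintegral_lintegral_sq_nnnorm_vecCons hΨm, Ψ.norm_eq]
    _ ≤ _ := lintegral_mono fun Y => sliceMass_le_landscapeIntegrand Ψ Y

/-- **The constant of `LandscapeBound` is at least `1`**: if the inner clause of the crux holds
at `(v, ρ)` with constant `C` (for eventually all `n` and every `δ > 0` a witness with landscape
functional `≤ C`), then `1 ≤ C` — whatever `v` and `ρ` are. [folklore] -/
theorem one_le_const_of_landscape {v : ℝ → ℝ≥0∞} {ρ C : ℝ}
    (h : ∀ᶠ n : ℕ in atTop, ∀ δ : ℝ≥0∞, 0 < δ →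
      ∃ Ψ : TrialState (n + 1) (sideLength ρ (n + 1)),
        energy v Ψ ≤ groundStateEnergy v (n + 1) (sideLength ρ (n + 1)) + δ ∧
        (∀ X, Ψ.ψ X = (‖Ψ.ψ X‖ : ℂ)) ∧
        ∫⁻ Y : Config n, ENNReal.ofReal (sideLength ρ (n + 1) ^ 3) *
            (∫⁻ x, (‖Ψ.ψ (Matrix.vecCons x Y)‖₊ : ℝ≥0∞) ^ 2) ^ 2 /
              (∫⁻ x, (‖Ψ.ψ (Matrix.vecCons x Y)‖₊ : ℝ≥0∞)) ^ 2 ≤ ENNReal.ofReal C) :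
    1 ≤ C := by
  obtain ⟨n, hn⟩ := h.exists
  obtain ⟨Ψ, -, -, hΨ⟩ := hn 1 one_pos
  exact ENNReal.one_le_ofReal.1 ((one_le_landscapeRatio Ψ).trans hΨ)

/-! ## A refuted natural strengthening: a universal constant -/

/-- **Strengthening of the crux with a UNIVERSAL constant** (`∀ C > 0` in place of `∃ C > 0`;
what "`E_Q[R] → 1 + o(1)` in the dilute limit, uniformly" would say if read with `C` arbitrary).
[folklore] -/
def LandscapeBoundAnyConst : Prop :=
  ∀ v : ℝ → ℝ≥0∞, IsRepulsiveFiniteRange v → ∃ ρ₀ : ℝ, 0 < ρ₀ ∧ ∀ ρ : ℝ, 0 < ρ → ρ < ρ₀ →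
    ∀ C : ℝ, 0 < C → ∀ᶠ n : ℕ in atTop, ∀ δ : ℝ≥0∞, 0 < δ →
      ∃ Ψ : TrialState (n + 1) (sideLength ρ (n + 1)),
        energy v Ψ ≤ groundStateEnergy v (n + 1) (sideLength ρ (n + 1)) + δ ∧
        (∀ X, Ψ.ψ X = (‖Ψ.ψ X‖ : ℂ)) ∧
        ∫⁻ Y : Config n, ENNReal.ofReal (sideLength ρ (n + 1) ^ 3) *
            (∫⁻ x, (‖Ψ.ψ (Matrix.vecCons x Y)‖₊ : ℝ≥0∞) ^ 2) ^ 2 /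
              (∫⁻ x, (‖Ψ.ψ (Matrix.vecCons x Y)‖₊ : ℝ≥0∞)) ^ 2 ≤ ENNReal.ofReal C

/-- **`LandscapeBoundAnyConst` is false**: at the free gas `v = 0` (admissible) and `C = 1/2`
no trial state whatsoever has landscape functional `≤ 1/2 < 1`. The crux's `∃ C` cannot be
upgraded to `∀ C`, and any proof must produce a constant `≥ 1` (for `v = 0` in fact
`≥ (π²/8)³`, see `freeGas_const_lt`). [folklore] -/
theorem not_landscapeBoundAnyConst : ¬ LandscapeBoundAnyConst := by
  intro h
  obtain ⟨ρ₀, hρ₀, H⟩ := h 0 ⟨measurable_const, ⟨0, fun _ _ => rfl⟩⟩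
  have := one_le_const_of_landscape
    (H (ρ₀ / 2) (by positivity) (by linarith) (1 / 2) (by norm_num))
  norm_num at this

/-- The crux with a PRESCRIBED constant `C` (same for all `v`, `ρ`). [folklore] -/
def LandscapeBoundConst (C : ℝ) : Prop :=
  ∀ v : ℝ → ℝ≥0∞, IsRepulsiveFiniteRange v → ∃ ρ₀ : ℝ, 0 < ρ₀ ∧ ∀ ρ : ℝ, 0 < ρ → ρ < ρ₀ →
    ∀ᶠ n : ℕ in atTop, ∀ δ : ℝ≥0∞, 0 < δ →
      ∃ Ψ : TrialState (n + 1) (sideLength ρ (n + 1)),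
        energy v Ψ ≤ groundStateEnergy v (n + 1) (sideLength ρ (n + 1)) + δ ∧
        (∀ X, Ψ.ψ X = (‖Ψ.ψ X‖ : ℂ)) ∧
        ∫⁻ Y : Config n, ENNReal.ofReal (sideLength ρ (n + 1) ^ 3) *
            (∫⁻ x, (‖Ψ.ψ (Matrix.vecCons x Y)‖₊ : ℝ≥0∞) ^ 2) ^ 2 /
              (∫⁻ x, (‖Ψ.ψ (Matrix.vecCons x Y)‖₊ : ℝ≥0∞)) ^ 2 ≤ ENNReal.ofReal C

/-- `LandscapeBoundConst C` implies the crux (it is a strengthening). [folklore] -/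
theorem landscapeBound_of_const {C : ℝ} (hC : 0 < C) (h : LandscapeBoundConst C) :
    LandscapeBound := by
  intro v hv
  obtain ⟨ρ₀, hρ₀, H⟩ := h v hv
  exact ⟨ρ₀, hρ₀, fun ρ hρ hlt => ⟨C, hC, H ρ hρ hlt⟩⟩

/-- **No constant `C < 1` works** (for any admissible `v`; witness `v = 0`). [folklore] -/
theorem not_landscapeBoundConst_of_lt_one {C : ℝ} (hC : C < 1) : ¬ LandscapeBoundConst C := by
  intro h
  obtain ⟨ρ₀, hρ₀, H⟩ := h 0 ⟨measurable_const, ⟨0, fun _ _ => rfl⟩⟩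
  have := one_le_const_of_landscape (H (ρ₀ / 2) (by positivity) (by linarith))
  linarith

/-! ## Unbounded: the functional is not controlled without the energy constraint

At fixed `(n, L)` the landscape functional is unbounded above on NONNEGATIVE admissible states
(sub-box power states), so the `∀ δ ∀ Ψ` reading of the crux is false (at `δ = ⊤`) and no
`L²`-type closeness can transfer the ratio (landed copy: `Theorems/LandscapeBound/Negative/RatioUnbounded.lean`). -/

/-- **Cauchy–Schwarz on a slice with prescribed support.** If every slice `x ↦ Ψ(x, Y)` vanishes
off a measurable set `S`, then `s(Y)² ≤ |S| · m(Y)`. [folklore] -/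
theorem lintegral_slice_sq_le_of_support (Ψ : TrialState (n + 1) L) {S : Set Space}
    (hS : MeasurableSet S) (h0 : ∀ (Y : Config n) (x : Space), x ∉ S → Ψ.ψ (Matrix.vecCons x Y) = 0)
    (Y : Config n) :
    (∫⁻ x, (‖Ψ.ψ (Matrix.vecCons x Y)‖₊ : ℝ≥0∞)) ^ 2 ≤
      volume S * ∫⁻ x, (‖Ψ.ψ (Matrix.vecCons x Y)‖₊ : ℝ≥0∞) ^ 2 := by
  have hΨm : Measurable Ψ.ψ := Ψ.contDiff.continuous.measurable
  have hg : Measurable fun x : Space => (‖Ψ.ψ (Matrix.vecCons x Y)‖₊ : ℝ≥0∞) :=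
    (measurable_comp_vecCons_left hΨm Y).nnnorm.coe_nnreal_ennreal
  set f : Space → ℝ≥0∞ := S.indicator 1 with hf
  have hfm : Measurable f := measurable_one.indicator hS
  have hfg : ∀ x, f x * (‖Ψ.ψ (Matrix.vecCons x Y)‖₊ : ℝ≥0∞) =
      (‖Ψ.ψ (Matrix.vecCons x Y)‖₊ : ℝ≥0∞) := by
    intro x
    by_cases hx : x ∈ S
    · simp [f, hx]
    · simp [f, hx, h0 Y x hx]
  have hf2 : ∫⁻ x, f x ^ 2 = volume S := by
    have : (fun x => f x ^ 2) = S.indicator 1 := by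
      funext x; by_cases hx : x ∈ S <;> simp [f, hx]
    rw [this, lintegral_indicator_one hS]
  calc (∫⁻ x, (‖Ψ.ψ (Matrix.vecCons x Y)‖₊ : ℝ≥0∞)) ^ 2
      = (∫⁻ x, f x * (‖Ψ.ψ (Matrix.vecCons x Y)‖₊ : ℝ≥0∞)) ^ 2 := by simp_rw [hfg]
    _ ≤ (∫⁻ x, f x ^ 2) * ∫⁻ x, (‖Ψ.ψ (Matrix.vecCons x Y)‖₊ : ℝ≥0∞) ^ 2 :=
        lintegral_mul_sq_le volume hfm.aemeasurable hg.aemeasurable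
    _ = _ := by rw [hf2]

/-- **Support lower bound for the landscape functional.** If every slice of `Ψ` is supported in a
measurable set `S` with `0 < |S| < ∞`, then `L³ / |S| ≤ ∫ L³ m²/s²` (pointwise
`(L³/|S|) m ≤ L³ m²/s²` from `s² ≤ |S| m`, then `∫ m = 1`). A state whose slices live in a small
set has a LARGE landscape functional. [folklore] -/
theorem div_volume_le_landscapeRatio (Ψ : TrialState (n + 1) L) {S : Set Space}
    (hS : MeasurableSet S) (h0 : ∀ (Y : Config n) (x : Space), x ∉ S → Ψ.ψ (Matrix.vecCons x Y) = 0)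
    (hS0 : volume S ≠ 0) (hStop : volume S ≠ ⊤) :
    ENNReal.ofReal (L ^ 3) / volume S ≤ ∫⁻ Y : Config n, ENNReal.ofReal (L ^ 3) *
      (∫⁻ x, (‖Ψ.ψ (Matrix.vecCons x Y)‖₊ : ℝ≥0∞) ^ 2) ^ 2 /
        (∫⁻ x, (‖Ψ.ψ (Matrix.vecCons x Y)‖₊ : ℝ≥0∞)) ^ 2 := by
  have hΨm : Measurable Ψ.ψ := Ψ.contDiff.continuous.measurable
  set A := ENNReal.ofReal (L ^ 3) with hA
  set V := volume S with hV
  have hpt : ∀ Y : Config n, A / V * ∫⁻ x, (‖Ψ.ψ (Matrix.vecCons x Y)‖₊ : ℝ≥0∞) ^ 2 ≤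
      A * (∫⁻ x, (‖Ψ.ψ (Matrix.vecCons x Y)‖₊ : ℝ≥0∞) ^ 2) ^ 2 /
        (∫⁻ x, (‖Ψ.ψ (Matrix.vecCons x Y)‖₊ : ℝ≥0∞)) ^ 2 := by
    intro Y
    have hslice : Measurable fun x : Space => (‖Ψ.ψ (Matrix.vecCons x Y)‖₊ : ℝ≥0∞) :=
      (measurable_comp_vecCons_left hΨm Y).nnnorm.coe_nnreal_ennreal
    set m := ∫⁻ x, (‖Ψ.ψ (Matrix.vecCons x Y)‖₊ : ℝ≥0∞) ^ 2 with hm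
    set s := ∫⁻ x, (‖Ψ.ψ (Matrix.vecCons x Y)‖₊ : ℝ≥0∞) with hs
    by_cases h0s : s = 0
    · have hm0 : m = 0 := by
        have h1 := (lintegral_eq_zero_iff hslice).1 h0s
        refine (lintegral_eq_zero_iff (hslice.pow_const 2)).2 ?_
        filter_upwards [h1] with x hx
        simp only [Pi.zero_apply] at hx ⊢
        simp [hx]
      rw [hm0, mul_zero]
      exact bot_le
    have hsfin : s ≠ ⊤ := (hasFiniteIntegral_iff_enorm.mp (integrable_slice Ψ Y).2).ne
    rw [ENNReal.le_div_iff_mul_le (Or.inl (pow_ne_zero 2 h0s)) (Or.inl (ENNReal.pow_ne_top hsfin))]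
    calc A / V * m * s ^ 2 ≤ A / V * m * (V * m) := by
          gcongr
          exact lintegral_slice_sq_le_of_support Ψ hS h0 Y
      _ = A / V * V * m ^ 2 := by ring
      _ = A * m ^ 2 := by rw [ENNReal.div_mul_cancel hS0 hStop]
  calc A / V = A / V * ∫⁻ Y : Config n, ∫⁻ x, (‖Ψ.ψ (Matrix.vecCons x Y)‖₊ : ℝ≥0∞) ^ 2 := by
        rw [lintegral_lintegral_sq_nnnorm_vecCons hΨm, Ψ.norm_eq, mul_one]
    _ = ∫⁻ Y : Config n, A / V * ∫⁻ x, (‖Ψ.ψ (Matrix.vecCons x Y)‖₊ : ℝ≥0∞) ^ 2 :=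
        (lintegral_const_mul' _ _ (ENNReal.div_ne_top ENNReal.ofReal_ne_top hS0)).symm
    _ ≤ _ := lintegral_mono hpt

/-! ### Nonnegative product states concentrated in a sub-box -/

/-- A NONNEGATIVE one-particle Dirichlet state of the box `Λ_ℓ` (normalised smooth bump centred in
the box; the construction of `TrialState.nonempty_one` with the sign tracked). [folklore] -/
theorem exists_nonneg_trialState_one {ℓ : ℝ} (hℓ : 0 < ℓ) :
    ∃ β : TrialState 1 ℓ, ∀ X, β.ψ X = (‖β.ψ X‖ : ℂ) := by
  let c : Config 1 := fun _ => WithLp.toLp 2 (fun _ : Fin 3 => ℓ / 2)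
  let f : ContDiffBump c := ⟨ℓ / 8, ℓ / 4, by positivity, by linarith⟩
  set A : ℝ≥0∞ := ∫⁻ X, (‖f X‖₊ : ℝ≥0∞) ^ 2 with hA
  have hmeas : Measurable (fun X => (‖f X‖₊ : ℝ≥0∞) ^ 2) :=
    (f.continuous.measurable.nnnorm.coe_nnreal_ennreal).pow_const 2
  have hAtop : A ≠ ⊤ := by
    have hint : Integrable (fun X => f X ^ 2) volume :=
      (f.continuous.pow 2).integrable_of_hasCompactSupport
        (f.hasCompactSupport.mul_left (f' := f))
    have := hint.2
    rw [HasFiniteIntegral] at this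
    refine ne_top_of_le_ne_top this.ne (le_of_eq ?_)
    refine lintegral_congr fun X => ?_
    rw [enorm_pow]
    rfl
  have hA0 : A ≠ 0 := by
    have h1 : volume (closedBall c f.rIn) ≤ A := by
      calc volume (closedBall c f.rIn) = ∫⁻ X in closedBall c f.rIn, 1 := (setLIntegral_one _).symm
        _ = ∫⁻ X in closedBall c f.rIn, (‖f X‖₊ : ℝ≥0∞) ^ 2 := by
            refine setLIntegral_congr_fun measurableSet_closedBall (fun X hX => ?_)
            rw [f.one_of_mem_closedBall hX]; simp
        _ ≤ A := setLIntegral_le_lintegral _ _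
    have h2 : 0 < volume (closedBall c f.rIn) := measure_closedBall_pos volume c (by
      show 0 < ℓ / 8; positivity)
    exact (h2.trans_le h1).ne'
  let k : ℝ≥0 := NNReal.sqrt (A.toNNReal)⁻¹
  have hk : (k : ℝ≥0∞) ^ 2 * A = 1 := by
    rw [← ENNReal.coe_pow, NNReal.sq_sqrt, ENNReal.coe_inv (ENNReal.toNNReal_ne_zero.2 ⟨hA0, hAtop⟩),
      ENNReal.coe_toNNReal hAtop, ENNReal.inv_mul_cancel hA0 hAtop]
  refine ⟨⟨fun X => (k : ℂ) * (f X : ℂ), ?_, ?_, ?_, ?_⟩, ?_⟩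
  · exact contDiff_const.mul (Complex.ofRealCLM.contDiff.comp f.contDiff)
  · intro X hX
    suffices f X = 0 by simp [this]
    rw [← Function.notMem_support, f.support_eq]
    intro hball
    apply hX
    intro i j
    have h1 : dist (X i) (c i) < ℓ / 4 := (dist_le_pi_dist X c i).trans_lt hball
    have h2 : dist (X i j) (ℓ / 2) < ℓ / 4 := (PiLp.dist_apply_le (X i) (c i) j).trans_lt h1
    rw [Real.dist_eq, abs_lt] at h2
    constructor <;> linarith [h2.1, h2.2]
  · intro σ X
    rw [Subsingleton.elim σ 1, Equiv.Perm.coe_one, Function.comp_id]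
  · have : ∀ X, (‖(k : ℂ) * (f X : ℂ)‖₊ : ℝ≥0∞) ^ 2 = (k : ℝ≥0∞) ^ 2 * (‖f X‖₊ : ℝ≥0∞) ^ 2 := by
      intro X
      rw [nnnorm_mul, ENNReal.coe_mul, mul_pow]
      congr 2
      · simp
      · rw [Complex.nnnorm_real]
    simp_rw [this]
    rw [lintegral_const_mul _ hmeas, hk]
  · intro X
    show (k : ℂ) * (f X : ℂ) = (‖(k : ℂ) * (f X : ℂ)‖ : ℂ)
    rw [norm_mul, Complex.norm_real, Complex.norm_real, Real.norm_of_nonneg k.coe_nonneg,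
      Real.norm_of_nonneg (f.nonneg' X)]
    push_cast
    rfl

/-- The one-body mode `x ↦ β(x)` of a one-particle state, as a function on `ℝ³`. [folklore] -/
def modeOf {ℓ : ℝ} (β : TrialState 1 ℓ) (x : Space) : ℂ := β.ψ fun _ => x

theorem oneFun_modeOf {ℓ : ℝ} (β : TrialState 1 ℓ) : oneFun (modeOf β) = β.ψ :=
  funext fun Y => congrArg β.ψ (const_apply_zero_eq Y)

theorem modeOf_eq_zero {ℓ : ℝ} (β : TrialState 1 ℓ) {x : Space} (hx : x ∉ box ℓ) :
    modeOf β x = 0 :=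
  β.eq_zero _ (by simpa [boxN] using hx)

/-- `Λ_ℓ ⊆ Λ_L` for `ℓ ≤ L`. [folklore] -/
theorem box_subset_box {ℓ L : ℝ} (h : ℓ ≤ L) : box ℓ ⊆ box L :=
  fun _ hx k => ⟨(hx k).1, (hx k).2.trans_le h⟩

/-- **The power state of a one-particle state of a sub-box**: all `N` particles in the mode of
`β ∈ TrialState 1 ℓ`, viewed as a Dirichlet trial state of the bigger box `Λ_L`, `ℓ ≤ L`.
[folklore] -/
def powStateOf {ℓ L : ℝ} (β : TrialState 1 ℓ) (hℓL : ℓ ≤ L) (N : ℕ) : TrialState N L where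
  ψ := powFun (modeOf β) N
  contDiff := contDiff_powFun (by rw [oneFun_modeOf]; exact β.contDiff) N
  eq_zero X hX := by
    have : ∃ i, X i ∉ box L := by simpa [boxN] using hX
    obtain ⟨i, hi⟩ := this
    exact powFun_eq_zero_of_exists _ ⟨i, modeOf_eq_zero β fun h => hi (box_subset_box hℓL h)⟩
  symm σ X := powFun_comp_perm _ σ X
  norm_eq := lintegral_powFun_sq (by rw [oneFun_modeOf]; exact β.contDiff)
    (by rw [oneFun_modeOf]; exact β.norm_eq) N

/-- The power of a nonnegative mode is nonnegative. [folklore] -/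
theorem powFun_nonneg {u : Space → ℂ} (hu : ∀ x, u x = (‖u x‖ : ℂ)) (N : ℕ) (X : Config N) :
    powFun u N X = (‖powFun u N X‖ : ℂ) := by
  unfold powFun
  rw [norm_prod, Complex.ofReal_prod]
  exact Finset.prod_congr rfl fun i _ => hu (X i)

/-- **Nonnegative trial states with arbitrarily large landscape functional.** For every `n`,
`0 < ℓ ≤ L` there is a NONNEGATIVE `Ψ ∈ TrialState (n+1) L` (a product bump living in the corner
sub-box `Λ_ℓ`) with `∫ L³ m²/s² ≥ L³/ℓ³`. So at fixed `(n, L)` the landscape functional is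
unbounded above on nonnegative admissible states: it is not controlled by the `L²` class, and any
`∀ Ψ` reading of the crux needs the energy constraint to do real work. [folklore] -/
theorem exists_nonneg_landscapeRatio_ge (n : ℕ) {ℓ L : ℝ} (hℓ : 0 < ℓ) (hℓL : ℓ ≤ L) :
    ∃ Ψ : TrialState (n + 1) L, (∀ X, Ψ.ψ X = (‖Ψ.ψ X‖ : ℂ)) ∧
      ENNReal.ofReal (L ^ 3) / ENNReal.ofReal (ℓ ^ 3) ≤ ∫⁻ Y : Config n, ENNReal.ofReal (L ^ 3) *
        (∫⁻ x, (‖Ψ.ψ (Matrix.vecCons x Y)‖₊ : ℝ≥0∞) ^ 2) ^ 2 /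
          (∫⁻ x, (‖Ψ.ψ (Matrix.vecCons x Y)‖₊ : ℝ≥0∞)) ^ 2 := by
  obtain ⟨β, hβ⟩ := exists_nonneg_trialState_one hℓ
  refine ⟨powStateOf β hℓL (n + 1),
    fun X => powFun_nonneg (u := modeOf β) (fun x => hβ fun _ => x) (n + 1) X, ?_⟩
  have hvol : volume (box ℓ) = ENNReal.ofReal (ℓ ^ 3) := by
    rw [volume_box, ENNReal.ofReal_pow hℓ.le]
  rw [← hvol]
  refine div_volume_le_landscapeRatio _ (measurableSet_box ℓ) (fun Y x hx => ?_) ?_ ?_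
  · show powFun (modeOf β) (n + 1) (Matrix.vecCons x Y) = 0
    rw [powFun_vecCons, modeOf_eq_zero β hx, zero_mul]
  · rw [hvol]; exact (ENNReal.ofReal_pos.2 (by positivity)).ne'
  · rw [hvol]; exact ENNReal.ofReal_ne_top

/-- **The `∀ δ, ∀ Ψ` reading of the crux is false.** Replacing `∀ δ > 0, ∃ Ψ` by `∀ δ > 0, ∀ Ψ`
(every nonnegative `δ`-near-minimiser obeys the bound, for every slack) fails already at `δ = ⊤`
(allowed: `δ : ℝ≥0∞`), where near-minimality is vacuous: nonnegative product bumps in a sub-box of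
side `L/(C+1)` have landscape functional `≥ (C+1)³ > C` (witness `v = 0`). [folklore] -/
theorem not_landscapeBound_forall_forall :
    ¬ ∀ v : ℝ → ℝ≥0∞, IsRepulsiveFiniteRange v → ∃ ρ₀ : ℝ, 0 < ρ₀ ∧ ∀ ρ : ℝ, 0 < ρ → ρ < ρ₀ →
      ∃ C : ℝ, 0 < C ∧ ∀ᶠ n : ℕ in atTop, ∀ δ : ℝ≥0∞, 0 < δ →
        ∀ Ψ : TrialState (n + 1) (sideLength ρ (n + 1)),
          energy v Ψ ≤ groundStateEnergy v (n + 1) (sideLength ρ (n + 1)) + δ →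
          (∀ X, Ψ.ψ X = (‖Ψ.ψ X‖ : ℂ)) →
          ∫⁻ Y : Config n, ENNReal.ofReal (sideLength ρ (n + 1) ^ 3) *
              (∫⁻ x, (‖Ψ.ψ (Matrix.vecCons x Y)‖₊ : ℝ≥0∞) ^ 2) ^ 2 /
                (∫⁻ x, (‖Ψ.ψ (Matrix.vecCons x Y)‖₊ : ℝ≥0∞)) ^ 2 ≤ ENNReal.ofReal C := by
  intro h
  obtain ⟨ρ₀, hρ₀, H⟩ := h 0 ⟨measurable_const, ⟨0, fun _ _ => rfl⟩⟩
  obtain ⟨C, hC, hev⟩ := H (ρ₀ / 2) (by positivity) (by linarith)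
  obtain ⟨n, hn⟩ := hev.exists
  set L := sideLength (ρ₀ / 2) (n + 1) with hL
  have hLpos : 0 < L := Real.rpow_pos_of_pos (div_pos (Nat.cast_pos.mpr n.succ_pos) (by positivity)) _
  have hC1 : 1 ≤ C + 1 := by linarith
  have hℓ : 0 < L / (C + 1) := by positivity
  have hℓL : L / (C + 1) ≤ L := div_le_self hLpos.le hC1
  obtain ⟨Ψ, hΨ, hge⟩ := exists_nonneg_landscapeRatio_ge n hℓ hℓL
  have hbd := hn ⊤ (by simp) Ψ (by simp) hΨ
  have key : ENNReal.ofReal ((C + 1) ^ 3) ≤ ENNReal.ofReal C := by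
    refine le_trans ?_ (hge.trans hbd)
    rw [← ENNReal.ofReal_div_of_pos (by positivity)]
    refine ENNReal.ofReal_le_ofReal (le_of_eq ?_)
    field_simp
  rw [ENNReal.ofReal_le_ofReal_iff hC.le] at key
  have h3 : C + 1 ≤ (C + 1) ^ 3 := le_self_pow₀ hC1 (by norm_num)
  linarith


/-! ## Near-misses (not closed; obstruction in the docstring) -/

/-- **Near-miss (free-gas sharp constant).** For `v = 0` every nonnegative `δ`-near-minimiser has
flat-mode occupation `occ(φ₀,Ψ) ≤ N((8/π²)³ + O(δL²/N))` (Dirichlet cube: ground mode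
`∏ √(2/L) sin(πx_k/L)`, `|⟨φ₀, φ_sin⟩|² = (8/π²)³`, gap `λ₂ - λ₁ = 3π²/L²`), hence by
`FlatModeFromLandscape` the landscape functional is `≥ (π²/8)³ - o(1) ≈ 1.878`; so
`LandscapeBoundConst C` fails for every `C < (π²/8)³`, not only `C < 1`. OBSTRUCTION: needs the
spectral gap of the Dirichlet Laplacian on the cube in the `C¹` trial class (a sine-series
Parseval for functions vanishing off the open cube; the tree has the Neumann cosine version,
`NeumannMomentumCutoffs`, not the Dirichlet one) and `E₀(0, N, L) = 3Nπ²/L²`. Tried: reuse of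
`BoseGasFreeDirichletBEC.key_inequality` (gives only a LOWER bound on sub-cell occupations).
[folklore] -/
theorem freeGas_const_lt {C : ℝ} (hC : C < (Real.pi ^ 2 / 8) ^ 3) : ¬ LandscapeBoundConst C := by
  sorry

/-- **Near-miss (the `∀ near-minimiser` form is false).** The strengthening of the crux in which,
for some `δ > 0`, EVERY nonnegative `δ`-near-minimiser obeys the landscape bound:
[folklore] -/
def LandscapeBoundForall : Prop :=
  ∀ v : ℝ → ℝ≥0∞, IsRepulsiveFiniteRange v → ∃ ρ₀ : ℝ, 0 < ρ₀ ∧ ∀ ρ : ℝ, 0 < ρ → ρ < ρ₀ →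
    ∃ C : ℝ, 0 < C ∧ ∀ᶠ n : ℕ in atTop, ∃ δ : ℝ≥0∞, 0 < δ ∧
      ∀ Ψ : TrialState (n + 1) (sideLength ρ (n + 1)),
        energy v Ψ ≤ groundStateEnergy v (n + 1) (sideLength ρ (n + 1)) + δ →
        (∀ X, Ψ.ψ X = (‖Ψ.ψ X‖ : ℂ)) →
        ∫⁻ Y : Config n, ENNReal.ofReal (sideLength ρ (n + 1) ^ 3) *
            (∫⁻ x, (‖Ψ.ψ (Matrix.vecCons x Y)‖₊ : ℝ≥0∞) ^ 2) ^ 2 /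
              (∫⁻ x, (‖Ψ.ψ (Matrix.vecCons x Y)‖₊ : ℝ≥0∞)) ^ 2 ≤ ENNReal.ofReal C

/-- **Near-miss: `¬ LandscapeBoundForall`** (spikes). At `v = 0`, fixed `n`, `L`, `δ > 0`: take a
nonnegative `δ/2`-near-minimiser `Φ` and the symmetric product spike `S_w = ∏ g_w(x_i - x*)`
(`g_w ≥ 0` a bump of width `w`, `‖g_w‖₂ = 1`); `Ψ_η = (Φ + η S_w)/‖·‖` is nonnegative, `C¹`,
symmetric, with energy `≤ E₀ + δ/2 + O(η² N / w²)` and landscape functional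
`≥ η² L³ ∫g_w⁴… ≳ η² L³ / w³` on the bath slices inside the spike; with `η² = δ w²/(4N)` the
functional is `≳ δ L³/(N w) = δ/(ρ w) → ∞` as `w → 0`. So for every `C` and every `δ > 0` there is
a nonnegative `δ`-near-minimiser violating the bound. OBSTRUCTION: a `C¹` near-minimiser of the
free Dirichlet problem with controlled energy is not in the tree as a term (the sine product is not
`C¹` across the faces); the spike algebra (`prodFun`/`powFun` energies exist in
`BoseGasProductState`/`BoseGasCatStates`) is routine but long. Informative content for the line:
the functional is not `L²`-continuous, so rigidity transfers occupations, never the ratio.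
[folklore] -/
theorem not_landscapeBoundForall : ¬ LandscapeBoundForall := by
  sorry


/-! ## Line `Sketch` (lead skeleton `Cruxes/LandscapeBound/Lines/Sketch.lean`) — stub review

No `-- Targets` this cycle (payload `stuck_stubs = []`). Review of the four stubs as filed:

* `stub_flatModeCondensate` (`L³ ≤ C ∫ s₀²`, `Ψ₀ = fkGroundState v (n+1) L`, bounded `v`): genuine
  object (`GroundStateFeynmanKac_holds` proved ⇒ normalised, positive, continuous), no junk branch
  of `fkGroundState` is reachable under the stub's hypotheses (`N = n+1 ≥ 1`, `L > 0`, bounded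
  measurable `v`). Content = flat-mode BEC of the Dirichlet ground state; free gas: `C = (π²/8)³`;
  interacting dilute gas: GP profile nearly flat, `C → 1⁺`. Constant necessarily `≥ 1`
  (`∫ s₀² ≤ L³ ∫ m₀ = L³`, Cauchy–Schwarz as in `lintegral_slice_sq_le`). OPEN-PROBLEM strength;
  not refutable here.
* `stub_removalChiSq` (`(∫ s₀²)(∫ m₀²/s₀²) ≤ C`): `= 1 + χ²(Q‖ν₀) ≥ 1` (Cauchy–Schwarz in `dY`);
  product states give exactly `1`; at Jastrow level `dQ/dν₀ ∝ L³ m₀/s₀² = R(Y)` is a spatial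
  average of local functionals of `Y`, so `χ² = Var_{ν₀} R / (E R)² = O(1/N)` if ground-state
  correlations decay — physically the EASY half, technically still needs decay of correlations of
  `Ψ₀`. Not refutable here; no finite model.
* `stub_witnessOfGroundState` (transfer at fixed `(n, L)`, `C ↦ C + 1`): hypothesis forces `C ≥ 1`
  (`ratio(Ψ₀) ≥ 1` by the same Cauchy–Schwarz, `Ψ₀` normalised and supported in the box), so the
  target `≤ C + 1` has slack `≥ 1` above `ratio(Ψ₀)`; regularisation (dilate + mollify + normalise)
  moves energy and ratio continuously (dominated convergence: integrand `≤ L³ ‖Ψ‖∞²` on a finite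
  box). Plausible / provable; no junk instance found (`E₀ < ⊤` for bounded `v`).
* `stub_singularPotentials` = the crux verbatim on `¬ bounded v`; contains the hard-sphere case AND
  a.e.-trivial unbounded profiles (`v = ⊤ · 1_{{0}}`: energetically the free gas since
  `{x_i = x_j}` is null) — harmless for truth, but shows the bounded/unbounded split is not the
  a.e.-class split a regularisation theory would want (`v` bounded a.e. on `(0, ∞)` would do).
  sharpen (for the lead, not a refutation): split on `∃ K, ∀ᵐ r, v r ≤ K` instead.
* Joint sufficiency: `LandscapeBound_of` is PROVED in the skeleton from the four stubs (checked:
  the skeleton elaborates with `sorry` only in stubs); no gap smuggled — for `Ψ₀` normalised and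
  supported in `Λ`, {flat-mode bound ∧ χ² bound} ⇔ landscape bound up to constants (split
  inequality one way, `∫ s₀² ≤ L³` and `χ² + 1 ≥ 1` the other way).
-/

end Summit.AtomisticToContinuum.BoseEinsteinCondensation.Cruxes.LandscapeBound.Disproof

end
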